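import Mathlib
import Summits.ResolutionOfSingularities.ResolutionOfSingularities.Theorems.RadicialJungCleanModelsLens5PRankTwoPort5
import HarnessLib

/-!
# Route `RadicialJung`, crux `CleanModels` (stmt-15917): CURRENCY of the T⁗-family port (the authors' `def`s, verbatim)

PORT (line lead `res-B-lead-1` g8, for Sketch rev 32) of res-B-lens-5's crux workfiles `Cruxes/DescentPerfectToAll/Lens5_TFrame.lean` rev 4
(crux ae884a356928; author res-B-lens-5 g15; `lean check` rc 0 · 0 sorries · 0 warnings; crit-1 TRIAGE-146/150 PASS) and
`Cruxes/DescentPerfectToAll/Lens5_PDegreeCount.lean` rev 3 (crux 100289d6413b; TRIAGE-151 PASS): THEOREMS T⁗ / T⁗′ / T⁗″ / T⁗‴ — the slice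
{`[Γ:pΓ] = p²`, `k` of FINITE `p`-rank `r`, `[κ_v : κ_v^p] = p^r`} of the research stub `stub_cleanLU3DefectNonDiscrete` (valuations of MINIMAL
Frobenius defect `d(K|K^p, v) = p`, ANY such ground field: no perfectness, no separability of `K/k` or `κ_v/k`), modulo F-02 `CossartPiltant2019` and
F-32 (`hEmb`) only.  The port is split into def-free modules `…Lens5TFrame{RG,IR,Graded,Port2,Port4Core,Layer,Layer2,Port4,Composition,PMon,PDegreeA,PDegreeB,PDegreeC}`
over ONE currency module `…Lens5TFrameCurrency` (the authors' `def`s, verbatim); declarations VERBATIM, namespace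
`Summit.ResolutionOfSingularities.ResolutionOfSingularities.Theorems.RadicialJungCleanModels.Lens5TFrame` (the authors' §A copy of
`Lens5_PDegreeSep` and the constant-frame corollaries `cleanLU3DefectPRankTwoSepFin_of_frame` / `…SepFin_of_cossartPiltant2019'` are not ported).
OURS · counted 0 · nothing here proves resolution in characteristic `p`.

This module: the slice predicates `CleanLU3DefectPRankTwoSepRkOneAt` / `…SepFinAt` / `…FrameAt` / `…PMonAt` / `…PBasisAt` / `…PDegAt`, the frame vocabulary `SepGenerated`, `IsPGenerator`, `ResiduallyPIndependent`, `IsPSpanningFamily`, `ResiduallyPIndependentFamily`, `pMonomial`, the PORT 4⁗ statement `FrameChartPort` and the expansion predicate `HasExp` (made `K`-explicit) — definitions only (review-queued per D-0009), no theorem.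
-/

set_option linter.dupNamespace false -- mandated namespace of this single-conjunct summit

section

open IsLocalRing
open Literature.AlgebraicGeometry.Resolution
open Summit.ResolutionOfSingularities.ResolutionOfSingularities.Theorems.RadicialJung.CleanModels
open Summit.ResolutionOfSingularities.ResolutionOfSingularities.Theorems.RadicialJung.CleanModels.Lens5
open Summit.ResolutionOfSingularities.ResolutionOfSingularities.Theorems.RadicialJung.CleanModels.Lens5.PRankTwoCurrency
open Summit.ResolutionOfSingularities.ResolutionOfSingularities.Theorems.RadicialJung.CleanModels.Lens5.PRankTwoAssembly
open Summit.ResolutionOfSingularities.ResolutionOfSingularities.Theorems.RadicialJungCleanModels.Lens5RegularityCriterion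
open Summit.ResolutionOfSingularities.ResolutionOfSingularities.Theorems.RadicialJungCleanModels.Lens5ChartSurjection

namespace Summit.ResolutionOfSingularities.ResolutionOfSingularities.Theorems.RadicialJungCleanModels.Lens5TFrame

/-! ## §B Currency of T′₁ (`p`-rank one; kept — T′₁ is the corollary `S := Fin p`, `b i := θ^i` of T′_fin, §H) -/

/-- `K/k` separably generated (census `Census_lens5_pRankTwo.lean` def, verbatim). [folklore] -/
def SepGenerated (k K : Type) [Field k] [Field K] [Algebra k K] : Prop :=
    ∃ (n : ℕ) (s : Fin n → K), AlgebraicIndependent k s ∧ Algebra.IsSeparable (IntermediateField.adjoin k (Set.range s)) K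

/-- **`θ` is a `p`-generator of `k`**: `k = k^p[θ] = Σ_{i<p} k^p θ^i`, i.e. `[k : k^p] ≤ p` (`p`-rank ≤ 1). [folklore] -/
def IsPGenerator (p : ℕ) {k : Type} [Field k] (θ : k) : Prop :=
    ∀ c : k, ∃ d : Fin p → k, c = ∑ i : Fin p, d i ^ p * θ ^ (i : ℕ)

/-- **Residual `p`-independence of `1, Θ, …, Θ^{p-1}`** along `v` (in-`K` form): a combination `Σ_{i<p} w_i^p Θ^i` with integral
coefficients one of which is a unit is a unit.  For `Θ ∈ k` and `κ_v/k` algebraic this says that the `p`-basis `{θ}` of `k` stays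
`p`-independent in `κ_v`, i.e. `κ_v/k` is separable. [folklore] -/
def ResiduallyPIndependent (p : ℕ) {K : Type} [Field K] (O : ValuationSubring K) (Θ : K) : Prop :=
    ∀ w : Fin p → K, (∀ i, w i ∈ O) → (∃ i, O.valuation (w i) = 1) →
      O.valuation (∑ i : Fin p, w i ^ p * Θ ^ (i : ℕ)) = 1

/-- **THEOREM T′₁'s slice**: `stub_cleanLU3DefectNonDiscrete` at `p` on {`[Γ : pΓ] = p²`, `K/k` separably generated, `k` of
`p`-rank ≤ 1 with `p`-generator `θ` residually `p`-independent along `v`} — NO `PerfectField k`. [folklore] -/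
def CleanLU3DefectPRankTwoSepRkOneAt (p : ℕ) : Prop :=
    ∀ (k : Type) [Field k] [CharP k p] (K : Type) [Field K] [Algebra k K]
    (O : ValuationSubring K) (A : Subalgebra k K), A.toSubring ≤ O.toSubring → A.FG → IsFractionRing A K →
    ringKrullDim A ≤ 3 → IsRegularLocalRing (locAtCentre A.toSubring O) →
    ringKrullDim (locAtCentre A.toSubring O) = 3 →
    (∀ (T : Subring K) (hT : T ≤ O.toSubring), A.toSubring ≤ T → (subringCentre T O hT).IsMaximal) →
    ∀ g₀ : K, (∀ c : K, c ^ p ≠ g₀) →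
    (∀ f₀ : K, ∃ f₁ : K, O.valuation (g₀ - f₁ ^ p) < O.valuation (g₀ - f₀ ^ p)) →
    (∀ hk : ∀ c : k, algebraMap k K c ∈ O, transcendenceDefect k O hk ≠ 0) →
    ¬ (∃ π : K, π ≠ 0 ∧ (∀ x : K, O.valuation x < 1 → O.valuation x ≤ O.valuation π) ∧
      (∀ x : K, x ≠ 0 → ∃ n : ℕ, O.valuation π ^ n ≤ O.valuation x)) →
    PRankTwoAt p O → SepGenerated k K →
    ∀ θ : k, IsPGenerator p θ → ResiduallyPIndependent p O (algebraMap k K θ) →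
    CleanLUConcl p k K O A g₀

/-! ### §B′ Currency of T′_fin (finite `p`-rank): a finite `p`-spanning family of `k`, residually `p`-independent along `v` -/

/-- **A finite `p`-spanning family of `k`**: `k = Σ_{s ∈ S} k^p · b_s` (`S` finite).  Any field of FINITE `p`-rank `e` has one
(the `p^e` monomials in a `p`-basis); `p`-rank one = the family `1, θ, …, θ^{p-1}`. [folklore] -/
def IsPSpanningFamily (p : ℕ) {k : Type} [Field k] {S : Type} [Fintype S] (b : S → k) : Prop :=
    ∀ c : k, ∃ d : S → k, c = ∑ s : S, d s ^ p * b s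

/-- **Residual `p`-independence of a finite family** `B : S → K` along `v` (in-`K` form): `Σ_s w_s^p B_s` is a `v`-unit whenever the
`w_s ∈ O` are not all in `𝔪_v`.  For `B = b` a `p`-spanning family of `k ⊆ O` and `κ_v/k` algebraic this says that the `p`-basis of `k`
extracted from `b` stays `p`-independent in `κ_v`, i.e. (MacLane) `κ_v/k` is SEPARABLE. [folklore] -/
def ResiduallyPIndependentFamily (p : ℕ) {K : Type} [Field K] (O : ValuationSubring K) {S : Type} [Fintype S]
    (B : S → K) : Prop :=
    ∀ w : S → K, (∀ s, w s ∈ O) → (∃ s, O.valuation (w s) = 1) → O.valuation (∑ s : S, w s ^ p * B s) = 1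

/-- **THEOREM T′_fin's slice**: `stub_cleanLU3DefectNonDiscrete` at `p` on {`[Γ : pΓ] = p²`, `K/k` separably generated, `k` with a
FINITE `p`-spanning family (finite `p`-rank) residually `p`-independent along `v`} — NO `PerfectField k`. [folklore] -/
def CleanLU3DefectPRankTwoSepFinAt (p : ℕ) : Prop :=
    ∀ (k : Type) [Field k] [CharP k p] (K : Type) [Field K] [Algebra k K]
    (O : ValuationSubring K) (A : Subalgebra k K), A.toSubring ≤ O.toSubring → A.FG → IsFractionRing A K →
    ringKrullDim A ≤ 3 → IsRegularLocalRing (locAtCentre A.toSubring O) →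
    ringKrullDim (locAtCentre A.toSubring O) = 3 →
    (∀ (T : Subring K) (hT : T ≤ O.toSubring), A.toSubring ≤ T → (subringCentre T O hT).IsMaximal) →
    ∀ g₀ : K, (∀ c : K, c ^ p ≠ g₀) →
    (∀ f₀ : K, ∃ f₁ : K, O.valuation (g₀ - f₁ ^ p) < O.valuation (g₀ - f₀ ^ p)) →
    (∀ hk : ∀ c : k, algebraMap k K c ∈ O, transcendenceDefect k O hk ≠ 0) →
    ¬ (∃ π : K, π ≠ 0 ∧ (∀ x : K, O.valuation x < 1 → O.valuation x ≤ O.valuation π) ∧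
      (∀ x : K, x ≠ 0 → ∃ n : ℕ, O.valuation π ^ n ≤ O.valuation x)) →
    PRankTwoAt p O → SepGenerated k K →
    ∀ (S : Type) [Fintype S] (b : S → k), IsPSpanningFamily p b →
    ResiduallyPIndependentFamily p O (fun s => algebraMap k K (b s)) →
    CleanLUConcl p k K O A g₀

/-! ### §B″ Currency of T⁗ (valuation `p`-frames): NO separability of `K/k`, NO residual separability -/

/-- **THEOREM T⁗'s slice**: `stub_cleanLU3DefectNonDiscrete` at `p` on {`[Γ : pΓ] = p²`, `k` of FINITE `p`-rank (a finite `p`-spanning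
family `b`, used ONLY to re-base `A` to `k^p`), and a finite MULTIPLICATIVE `p`-FRAME `W ⊆ O_v` — `W_s W_t, 1 ∈ Σ_u K^p W_u` — which is
residually `p`-independent along `v` with `[K : K^p(W)] = p³`} — NO `PerfectField k`, NO `SepGenerated k K`, NO separability of `κ_v/k`.
Frames: `W = 1` (perfect `k`: THEOREM T); `W = b` read in `K` (T′_fin, `cleanLU3DefectPRankTwoSepFin_of_frame`); `W =` the `p^r`
monomials in lifts of a `p`-basis of `κ_v/κ_v^p` whenever `[κ_v : κ_v^p] = [k : k^p] = p^r` — e.g. EVERY `v` with `κ_v/k` finite over a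
ground field of finite `p`-rank, separable or not, `K/k` separably generated or not (memo CLASSBC §23). [folklore] -/
def CleanLU3DefectPRankTwoFrameAt (p : ℕ) : Prop :=
    ∀ (k : Type) [Field k] [CharP k p] (K : Type) [Field K] [Algebra k K]
    (O : ValuationSubring K) (A : Subalgebra k K), A.toSubring ≤ O.toSubring → A.FG → IsFractionRing A K →
    ringKrullDim A ≤ 3 → IsRegularLocalRing (locAtCentre A.toSubring O) →
    ringKrullDim (locAtCentre A.toSubring O) = 3 →
    (∀ (T : Subring K) (hT : T ≤ O.toSubring), A.toSubring ≤ T → (subringCentre T O hT).IsMaximal) →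
    ∀ g₀ : K, (∀ c : K, c ^ p ≠ g₀) →
    (∀ f₀ : K, ∃ f₁ : K, O.valuation (g₀ - f₁ ^ p) < O.valuation (g₀ - f₀ ^ p)) →
    (∀ hk : ∀ c : k, algebraMap k K c ∈ O, transcendenceDefect k O hk ≠ 0) →
    ¬ (∃ π : K, π ≠ 0 ∧ (∀ x : K, O.valuation x < 1 → O.valuation x ≤ O.valuation π) ∧
      (∀ x : K, x ≠ 0 → ∃ n : ℕ, O.valuation π ^ n ≤ O.valuation x)) →
    PRankTwoAt p O →
    ∀ (Sb : Type) [Fintype Sb] (b : Sb → k), IsPSpanningFamily p b →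
    ∀ (S : Type) [Fintype S] (W : S → K), (∀ s, W s ∈ O) → ResiduallyPIndependentFamily p O W →
    (∀ s t : S, ∃ d : S → K, W s * W t = ∑ u : S, d u ^ p * W u) → (∃ d : S → K, ∑ u : S, d u ^ p * W u = 1) →
    Module.finrank (Subfield.closure (Set.range W ∪ Set.range (fun x : K => x ^ p))) K = p ^ 3 →
    CleanLUConcl p k K O A g₀


/-! ### Currency of §G⁗ (PORT 4⁗'s statement), of the frame layer §G⁗.B and of §I (`p`-monomial frames) -/

/-- **PORT 4⁗ (typed obligation, NOT proved in this file): regularity of the frame-extended chart algebra with a regular parameter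
in `M`.**  Hypotheses = Port 4b's (`port_regularParameter`, ✓ Port4b) over an arbitrary ground field `k` (applied below to `k₀ = k^p`),
with `K`-valued parameters `z` of `T := locAtCentre A₂ O ⊆ M` (spanning `𝔪_T` in `K`-form), plus the frame data: `W : S → O_v^×`
residually graded over `M` (RG), `M`-linearly independent jointly with `x^a y^b` (`a, b < p`, `x^p, y^p ∈ M`), the chart monomials
`u_j = z^{e_j} x^{a_j} y^{b_j}`, and a finite generator list `t ∋ 1, W_s, W_s W_{s'}` with `A ≤ k[t]`, every member of which is a
unit-weighted sum of frame-chart monomials `ν_l W_{σ l} u^{d_l}` (`d_{<ρ} ≥ 0`).  Conclusion = Port 4b's.  See §G⁗ for the hand proof. [folklore] -/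
def FrameChartPort (p : ℕ) : Prop :=
    ∀ (k : Type) [Field k] (K : Type) [Field K] [Algebra k K] (O : ValuationSubring K) (A : Subalgebra k K)
    (hAO : A.toSubring ≤ O.toSubring), A.FG → IsFractionRing A K → ringKrullDim A ≤ 3 →
    ringKrullDim (locAtCentre A.toSubring O) = 3 →
    (∀ (T : Subring K) (hT : T ≤ O.toSubring), A.toSubring ≤ T → (subringCentre T O hT).IsMaximal) →
    ∀ (M : Subfield K) (A₂ : Subalgebra k K) (hA₂O : A₂.toSubring ≤ O.toSubring), A₂.FG →
    (∀ a ∈ A, a ^ p ∈ A₂) → (∀ r : K, r ∈ locAtCentre A₂.toSubring O → r ∈ M) →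
    IsRegularLocalRing (locAtCentre A₂.toSubring O) → ringKrullDim (locAtCentre A₂.toSubring O) = 3 →
    ∀ (z : Fin 3 → K), (∀ i, z i ∈ locAtCentre A₂.toSubring O) → (∀ i, z i ≠ 0) → (∀ i, O.valuation (z i) < 1) →
    (∀ r : K, r ∈ locAtCentre A₂.toSubring O → O.valuation r < 1 →
      ∃ b : Fin 3 → K, (∀ i, b i ∈ locAtCentre A₂.toSubring O) ∧ r = ∑ i, b i * z i) →
    -- the frame
    ∀ (S : Type) [Fintype S] (W : S → K), (∀ s, W s ∈ O) → (∀ s, O.valuation (W s) = 1) →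
    (∀ c : S → K, (∀ s, c s ∈ M) → O.valuation (∑ s, c s * W s) = Finset.univ.sup (fun s => O.valuation (c s))) →
    ∀ (x y : K), x ≠ 0 → y ≠ 0 → x ^ p ∈ M → y ^ p ∈ M → O.valuation x < 1 → O.valuation y < 1 →
    (∀ f : S × (Fin p × Fin p) → K, (∀ l, f l ∈ M) →
      ∑ l, f l * (W l.1 * (x ^ (l.2.1 : ℕ) * y ^ (l.2.2 : ℕ))) = 0 → ∀ l, f l = 0) →
    -- values: `M` has `p`-th-power values, (P2) for `x, y`, and the DOUBLE GRADEDNESS DG of the frame `{W_s x^a y^b}` over `M`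
    (∀ m : K, m ∈ M → m ≠ 0 → ∃ w : K, w ≠ 0 ∧ O.valuation m = O.valuation (w ^ p)) →
    (∀ a b : ℕ, a < p → b < p → (a ≠ 0 ∨ b ≠ 0) → ∀ z : K, z ≠ 0 → O.valuation (x ^ a * y ^ b) ≠ O.valuation (z ^ p)) →
    (∀ m : S × (Fin p × Fin p) → K, (∀ l, m l ∈ M) → ∀ l₀ : S × (Fin p × Fin p),
      O.valuation (m l₀ * (W l₀.1 * (x ^ (l₀.2.1 : ℕ) * y ^ (l₀.2.2 : ℕ)))) ≤
        O.valuation (∑ l, m l * (W l.1 * (x ^ (l.2.1 : ℕ) * y ^ (l.2.2 : ℕ))))) →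
    -- the generator list: contains `1`, the frame and its pairwise products, and generates an algebra containing `A`
    ∀ (t : Finset K), (∀ a ∈ t, a ∈ O) → A ≤ Algebra.adjoin k (t : Set K) → (1 : K) ∈ t → (∀ s, W s ∈ t) →
    (∀ s s' : S, W s * W s' ∈ t) →
    -- the toric chart
    ∀ (ρ : ℕ), (ρ = 1 ∨ ρ = 2) → ∀ (u : Fin 3 → K), (∀ j, u j ≠ 0) →
    (∀ j : Fin 3, (j : ℕ) < ρ → O.valuation (u j) < 1) → (∀ j : Fin 3, ρ ≤ (j : ℕ) → O.valuation (u j) = 1) →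
    (∀ j : Fin 3, ρ ≤ (j : ℕ) → u j ∈ M) →
    (∀ j : Fin 3, ∃ (e : Fin 3 → ℤ) (a b : ℕ), u j = (∏ i, z i ^ e i) * (x ^ a * y ^ b)) →
    (∀ i : Fin 3, ∃ (ε : K) (d : Fin 3 → ℤ), ε ∈ locAtCentre A₂.toSubring O ∧ O.valuation ε = 1 ∧
      (∀ j : Fin 3, (j : ℕ) < ρ → 0 ≤ d j) ∧ (∃ j : Fin 3, (j : ℕ) < ρ ∧ 0 < d j) ∧ z i = ε * ∏ j, u j ^ d j) →
    -- the normal forms of the generators in the frame chart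
    ∀ (L : Type) [Fintype L] (σ : L → S),
    (∀ a ∈ t, ∃ (ν : L → K) (d : L → Fin 3 → ℤ),
      (∀ l, ν l = 0 ∨ (ν l ∈ locAtCentre A₂.toSubring O ∧ O.valuation (ν l) = 1)) ∧
      (∀ l, ∀ j : Fin 3, (j : ℕ) < ρ → 0 ≤ d l j) ∧ a = ∑ l, ν l * W (σ l) * ∏ j, u j ^ d l j) →
    ∃ (A'' : Subalgebra k K), A''.toSubring ≤ O.toSubring ∧ A ≤ A'' ∧ A''.FG ∧
      ∃ (_ : IsRegularLocalRing (locAtCentre A''.toSubring O)) (ψ : locAtCentre A''.toSubring O),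
        ψ ∈ IsLocalRing.maximalIdeal (locAtCentre A''.toSubring O) ∧
        ψ ∉ (IsLocalRing.maximalIdeal (locAtCentre A''.toSubring O)) ^ 2 ∧ (ψ : K) ∈ M

/-- `a` has an expansion `Σ_s e_s W_s` with coefficients in the subring `S₀`. -/
def HasExp {K : Type} [Field K] {ι : Type} [Fintype ι] (S₀ : Subring K) (W : ι → K) (a : K) : Prop :=
  ∃ e : ι → K, (∀ s, e s ∈ S₀) ∧ a = ∑ s, e s * W s

/-- The `p`-monomials `W_e := ∏ i, w_i ^ {e_i}` (`0 ≤ e_i < p`) of a finite family `w : Fin r → K`. [folklore] -/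
def pMonomial (p : ℕ) {K : Type} [Field K] {r : ℕ} (w : Fin r → K) (e : Fin r → Fin p) : K := ∏ i, w i ^ (e i : ℕ)

/-- **THEOREM T⁗′'s slice** (`p`-monomial frames): `stub_cleanLU3DefectNonDiscrete` at `p` on {`[Γ : pΓ] = p²`, `k` of finite `p`-rank,
`r` elements `w_i ∈ O_v` whose `p`-monomials are residually `p`-independent (= residues `p`-independent over `κ_v^p`), `[K : K^p] = p^{r+3}`}.
NO (MULT)/(1)/(DEG), no hypothesis on `K/k` or `κ_v/k`.  Binders through `hnd` are those of the lead's stub (token-identical with §B″). [folklore] -/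
def CleanLU3DefectPRankTwoPMonAt (p : ℕ) : Prop :=
    ∀ (k : Type) [Field k] [CharP k p] (K : Type) [Field K] [Algebra k K]
    (O : ValuationSubring K) (A : Subalgebra k K), A.toSubring ≤ O.toSubring → A.FG → IsFractionRing A K →
    ringKrullDim A ≤ 3 → IsRegularLocalRing (locAtCentre A.toSubring O) →
    ringKrullDim (locAtCentre A.toSubring O) = 3 →
    (∀ (T : Subring K) (hT : T ≤ O.toSubring), A.toSubring ≤ T → (subringCentre T O hT).IsMaximal) →
    ∀ g₀ : K, (∀ c : K, c ^ p ≠ g₀) →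
    (∀ f₀ : K, ∃ f₁ : K, O.valuation (g₀ - f₁ ^ p) < O.valuation (g₀ - f₀ ^ p)) →
    (∀ hk : ∀ c : k, algebraMap k K c ∈ O, transcendenceDefect k O hk ≠ 0) →
    ¬ (∃ π : K, π ≠ 0 ∧ (∀ x : K, O.valuation x < 1 → O.valuation x ≤ O.valuation π) ∧
      (∀ x : K, x ≠ 0 → ∃ n : ℕ, O.valuation π ^ n ≤ O.valuation x)) →
    PRankTwoAt p O →
    ∀ (Sb : Type) [Fintype Sb] (b : Sb → k), IsPSpanningFamily p b →
    ∀ (r : ℕ) (w : Fin r → K), (∀ i, w i ∈ O) → ResiduallyPIndependentFamily p O (pMonomial p w) →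
    Module.finrank (Subfield.closure (Set.range (fun x : K => x ^ p))) K = p ^ (r + 3) →
    CleanLUConcl p k K O A g₀

/-! ### Currency of `Lens5_PDegreeCount.lean` §D / §H (THEOREMS T⁗″ / T⁗‴) -/

/-- **THEOREM T⁗″'s slice**: `stub_cleanLU3DefectNonDiscrete` at `p` on {`[Γ : pΓ] = p²`, `k` with a finite `p`-BASIS `β` of `r` elements
(`k = k^p[β]`: the `p`-monomials of `β` `p`-span `k`, and `β` is `p`-free), `r` elements `w_i ∈ O_v` whose `p`-monomials are residually
`p`-independent} — i.e. (P2) with `[κ_v : κ_v^p] = [k : k^p] = p^r` (the residue field is NOT `p`-radically deficient).  No hypothesis on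
`K/k` (separably generated or not) or on `κ_v/k` (separable, inseparable, infinite …); no count.  Binders through `hnd` are those of the
lead's stub (token-identical with `CleanLU3DefectPRankTwoPMonAt`). [folklore] -/
def CleanLU3DefectPRankTwoPBasisAt (p : ℕ) : Prop :=
    ∀ (k : Type) [Field k] [CharP k p] (K : Type) [Field K] [Algebra k K]
    (O : ValuationSubring K) (A : Subalgebra k K), A.toSubring ≤ O.toSubring → A.FG → IsFractionRing A K →
    ringKrullDim A ≤ 3 → IsRegularLocalRing (locAtCentre A.toSubring O) →
    ringKrullDim (locAtCentre A.toSubring O) = 3 →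
    (∀ (T : Subring K) (hT : T ≤ O.toSubring), A.toSubring ≤ T → (subringCentre T O hT).IsMaximal) →
    ∀ g₀ : K, (∀ c : K, c ^ p ≠ g₀) →
    (∀ f₀ : K, ∃ f₁ : K, O.valuation (g₀ - f₁ ^ p) < O.valuation (g₀ - f₀ ^ p)) →
    (∀ hk : ∀ c : k, algebraMap k K c ∈ O, transcendenceDefect k O hk ≠ 0) →
    ¬ (∃ π : K, π ≠ 0 ∧ (∀ x : K, O.valuation x < 1 → O.valuation x ≤ O.valuation π) ∧
      (∀ x : K, x ≠ 0 → ∃ n : ℕ, O.valuation π ^ n ≤ O.valuation x)) →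
    PRankTwoAt p O →
    ∀ (r : ℕ) (β : Fin r → k), IsPSpanningFamily p (pMonomial p β) →
    (∀ i, β i ∉ Subfield.closure (Set.range (fun x : k => x ^ p) ∪ β '' ({i}ᶜ : Set (Fin r)))) →
    ∀ (w : Fin r → K), (∀ i, w i ∈ O) → ResiduallyPIndependentFamily p O (pMonomial p w) →
    CleanLUConcl p k K O A g₀

/-- **THEOREM T⁗‴'s slice (canonical hypotheses)**: `stub_cleanLU3DefectNonDiscrete` at `p` on {`[Γ : pΓ] = p²`, `[k : k^p] = p^r`,
`[κ_v : κ_v^p] = p^r`} — the value group mod `p` and the two `p`-DEGREES (finranks over the subfields of `p`-th powers of `k` and of the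
residue field `κ_v = O_v/𝔪_v`), nothing else: no frame, no `p`-basis, no count, no hypothesis on `K/k` or `κ_v/k`.  Under :279's `hzd`
(`κ_v/k` algebraic) `[κ_v : κ_v^p] ≤ [k : k^p]` always, so this is «(P2) and the residue field is NOT `p`-radically deficient» = the slice of
MINIMAL DEFECT `d(K|K^p, v) = p` (memo §27).  Binders through `hnd` token-identical with `CleanLU3DefectPRankTwoPMonAt`. [folklore] -/
def CleanLU3DefectPRankTwoPDegAt (p : ℕ) : Prop :=
    ∀ (k : Type) [Field k] [CharP k p] (K : Type) [Field K] [Algebra k K]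
    (O : ValuationSubring K) (A : Subalgebra k K), A.toSubring ≤ O.toSubring → A.FG → IsFractionRing A K →
    ringKrullDim A ≤ 3 → IsRegularLocalRing (locAtCentre A.toSubring O) →
    ringKrullDim (locAtCentre A.toSubring O) = 3 →
    (∀ (T : Subring K) (hT : T ≤ O.toSubring), A.toSubring ≤ T → (subringCentre T O hT).IsMaximal) →
    ∀ g₀ : K, (∀ c : K, c ^ p ≠ g₀) →
    (∀ f₀ : K, ∃ f₁ : K, O.valuation (g₀ - f₁ ^ p) < O.valuation (g₀ - f₀ ^ p)) →
    (∀ hk : ∀ c : k, algebraMap k K c ∈ O, transcendenceDefect k O hk ≠ 0) →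
    ¬ (∃ π : K, π ≠ 0 ∧ (∀ x : K, O.valuation x < 1 → O.valuation x ≤ O.valuation π) ∧
      (∀ x : K, x ≠ 0 → ∃ n : ℕ, O.valuation π ^ n ≤ O.valuation x)) →
    PRankTwoAt p O →
    ∀ r : ℕ, Module.finrank (Subfield.closure (Set.range (fun x : k => x ^ p))) k = p ^ r →
    Module.finrank (Subfield.closure (Set.range (fun x : IsLocalRing.ResidueField O => x ^ p))) (IsLocalRing.ResidueField O) = p ^ r →
    CleanLUConcl p k K O A g₀

end Summit.ResolutionOfSingularities.ResolutionOfSingularities.Theorems.RadicialJungCleanModels.Lens5TFrame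

end
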